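import Literature.NumberTheory.EllipticCurves.MazurTateElementOddPairProofs
import Literature.NumberTheory.EllipticCurves.PAdicLFunctionFrickeSymmetryProofs
import Literature.Barriers.BirchSwinnertonDyer.PAdicFunctionalEquationSharpFlatTwoProofs
import HarnessLib

/-!
# AN-9 (cell `bsd-f1-sign2`, seat `-an`, g3): the functional equation of Sprung's pair
# `(L♯₋, L♭₋)` on the ODD (`χ₋₄`) branch at `p = 2`, `a₂ = 0`, and its value shadows — kernel file

TURNKEY filing by the typer seat `bsd-f1-sign2-ty` (D-ty-6, part 1/6 of -an g3's kernel file `OddFE.lean`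
200de6ab6bb130d9, pre-split by the planner): `HOME/MEMO-an-data/g3/split/OddBranchFEAtTwoPrelim.lean` sha16 39b46d084fdea340
(joint farm checks `JointA_parts1to4` 000c30d5de228c06 / `JointB_parts1to6` cbbe6a2064807d53: rc 0, 0 warnings, 0 sorries),
re-filed VERBATIM. PROOF-ONLY module (theorems; no definition, no named fact). REF2-PLACEMENT-v8 §0: the odd-branch
functional equation at 2 is IN PRINT (Sprung, ANT 11 (2017), Cor. 4.14 at (p, i) = (2, 1); Sprung arXiv:1211.1352 Thm 3.16 /
Cor 3.17) — formalised here, not new; beyond-print theorem: no for the FE itself (value corollaries: REF2 placing).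

For `f ∈ S₂(Γ₀(N))` rational (`coeffField f = ⊥`) of odd level with Fricke sign `−σ`
(`f|w_N = −σ f`, `σ = ±1`), `N = η_N · 5^c` in `ℤ₂^× = {±1} × 5^{ℤ₂}` (`η_N = χ₄(N) = ±1`,
`c ∈ ℤ₂`), `a = −2/3`, `b = −1/3 ∈ ℤ₂`, and ANY pair `(L♯₋, L♭₋) ∈ Λ²` with
`θ⁻_n ≡ −(u_n L♯₋ + v_n L♭₋) (mod ω_n)` for all `n` (`IsSprungPairOdd f 2 0 L♯₋ L♭₋`, the tree's
carrier `MazurTateElementOdd`; it exists and is unique by `MazurTateElementOddPairProofs`):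

  `L♯₋(T^ι) = ε (1+T)^{c+a} L♯₋(T)`,  `L♭₋(T^ι) = ε (1+T)^{c+b} L♭₋(T)`,  `T^ι = (1+T)⁻¹ − 1`,
  **`ε = −σ · η_N = −σ · χ₄(N)`** (`= w_E · χ₋₄(−N_E) = w(E ⊗ χ₋₄)` at the conductor level).

This is the odd-branch twin of the tree's EVEN-branch functional equation
`Literature/Barriers/BirchSwinnertonDyer/PAdicFunctionalEquationSharpFlatTwoProofs`
(`subst_invOnePlusSubOne_eq_of_isSprungPair_two`, sign `σ`), proved by the same finite-level route:
§4 the functional equation of the odd Mazur–Tate elements `θ⁻_n(T^ι) ≡ ε (1+T)^{c_n} θ⁻_n(T)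
(mod ω_n Λ)` (the `Δ`-doubled single sum `θ⁻_n = Σ_s 2[5^s/2^{n+2}]⁻ (1+T)^s`,
`mazurTateElementOdd_two_eq`, IS `2`-integral — `‖[a/2^k]⁻‖₂ ≤ 2`, `norm_ratMinusSymbol_two_le_two` —
so no doubling factor is needed; the involution `s ↦ −s_N − s` of `ℤ/2ⁿ` and the Fricke symmetry of the
MINUS symbols `[u/2^{n+2}]⁻ = σ[u'/2^{n+2}]⁻` for `u u' N ≡ −1`, §0, with `u' = −η_N 5^{−s_N−s}` and
`[−x]⁻ = −[x]⁻` — the source of the extra factor `−η_N`); §6 transport under `ι` (verbatim the even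
file's `isSprungPair_two_zero_transport`, abstracted over the finite-level functional equation);
§7 uniqueness of the odd pair (`IsSprungPairOdd.unique`). §1–§3, §5 are COPIES of the even file's
private helpers (binomial series modulo `ω_n`, `ι` on `Λ`, the exponents `a, b`), which are `private`
there and hence not importable — the typer may de-privatise instead of duplicating.

§8–§9: CONSEQUENCES FOR THE VALUES (elliptic curve `E = W`, good reduction at `2`, `a₂(E) = 0`, every
odd pair; `s := −w_E χ₄(N) = w(E^{(−1)})`, `s·χ₈(N) = w(E^{(−2)})`). §8 reads the pair at `T = 0` and
`T = −2`: `L♯₋(0) = 0` (g2), `L♭₋(0) = −2[1/4]⁻` (`coe_constantCoeff_oddFlat_eq`), `L♯₋(−2) =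
−2([1/8]⁻ − [5/8]⁻)` (`coe_evalAt_oddSharp_neg_two_eq`). §9 compares coefficients in the functional
equation (`a` even, `b` odd; `c` even iff `χ₈(N) = +1`, `neg_one_pow_val_eq_chi8`):
* `s = +1 ⇒ ℓ₁ = 0 ⇒ T² ∣ L♯₋` (`X_sq_dvd_oddSharp_of_sign`, AN-6 double zero when `w(E^{(−1)}) = +1`);
* `s = +1 ∨ χ₈(N) = +1 ⇒ 4 ∣ L♯₋(−2)`, i.e. `‖[1/8]⁻ − [5/8]⁻‖₂ < 1` (AN-9V2:
  `four_dvd_evalAt_oddSharp_neg_two`, `norm_sub_ratMinusSymbol_eighth_lt_one`; a priori `≤ 2`);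
* `χ₈(N) = +1 ⇒ 2 ∣ L♭₋(0)`, i.e. `‖[1/4]⁻‖₂ ≤ 1` (AN-9V1: `two_dvd_constantCoeff_oddFlat_of_chi8`,
  `norm_ratMinusSymbol_quarter_le_one_of_chi8`; a priori `≤ 2`);
* sign anchor: `s = −1 ⇒ [1/4]⁻ = 0` (`ratMinusSymbol_quarter_eq_zero_of_sign`: `L(E^{(−1)}, 1) = 0`
  when `w(E^{(−1)}) = −1` — the classical shadow that pins the sign convention).
The content cases (`w(E^{(−1)}) = +1 ∧ χ₈(N) = +1`, where `w(E^{(−2)}) = +1` as well) are 2-adic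
divisibilities of (generically non-zero) twisted central symbols; elsewhere the symbol vanishes
classically. MEMO-an §3 census (tree units): V1 20/20, V2 15/15 curves, 0 violations.

References (shape only; nothing beyond the displayed hypotheses is asserted):
* F. Sprung, *On pairs of `p`-adic `L`-functions for weight-two modular forms*, Algebra & Number
  Theory 11 (2017), Thm. 1.12 ("Fix a tame character `ω^i`"), Cor. 4.4, §3.5 and Cor. 4.14
  (functional equation at `a_p = 0`). [Sprung2017]
* B. Mazur, J. Tate, J. Teitelbaum, Invent. Math. 84 (1986), §I.13, §I.17 (functional equation of
  `θ_n(χ, T)`: sign `c_N ε̄ χ(−N)`), §I.8 (`[−r]⁻ = −[r]⁻`). [MazurTateTeitelbaum1986Invent]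
* R. Greenberg, LNM 1716 (1999), §1 pp. 67–68 (the sign of the `p`-adic functional equation is the
  root number). [GreenbergLNM1716]
-/

set_option autoImplicit false

noncomputable section

open scoped MatrixGroups ModularForm

open CongruenceSubgroup PowerSeries Filter Topology
  Literature.NumberTheory.EllipticCurves Literature.NumberTheory.EllipticCurves.ModularForms
  Literature.NumberTheory.EllipticCurves.Sprung2017 Literature.Barriers.BirchSwinnertonDyer

/-! ## §0. Fricke symmetry of the MINUS symbols (AN-9F, g2) -/

namespace Literature.NumberTheory.EllipticCurves.ModularForms

section Symbols

variable {N : ℕ} [NeZero N] {f : CuspForm (Gamma0 N) 2}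

/-- **Fricke symmetry of the minus symbols**: under the hypotheses of
`IsFrickeEigen.modularSymbol_div_eq_neg_mul`,
`({∞, u/m} - {∞, -u/m})/2 = -ε ({∞, v/m} - {∞, -v/m})/2` (apply the symbol relation to `(u, v)` and to
`(-u, -v)`, which satisfies the same determinant condition). [cite: MazurTateTeitelbaum1986Invent, §I.17] -/
theorem IsFrickeEigen.minusSymbol_div_eq_neg_mul' {ε : ℂ} (hW : IsFrickeEigen N f ε)
    (hε : ε ^ 2 = 1) {m : ℕ} (hm : 0 < m) {a u v : ℤ} (huv : a * m - u * (N * v) = 1) :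
    minusSymbol f ((u : ℚ) / m) = -ε * minusSymbol f ((v : ℚ) / m) := by
  have h1 := hW.modularSymbol_div_eq_neg_mul hε hm huv
  have huv' : a * m - (-u) * (N * (-v)) = 1 := by linear_combination huv
  have h2 := hW.modularSymbol_div_eq_neg_mul hε hm huv'
  have hu : (((-u : ℤ) : ℚ) / m) = -((u : ℚ) / m) := by push_cast; ring
  have hv : (((-v : ℤ) : ℚ) / m) = -((v : ℚ) / m) := by push_cast; ring
  rw [hu, hv] at h2
  simp only [minusSymbol]
  rw [h1, h2]
  ring

/-- **Fricke symmetry of the normalised minus symbols `[r]⁻ = im(minusSymbol)/Ω⁻_f`**, with the sign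
written as an integer: if `f(-1/(Nτ)) = -σ N τ² f(τ)` with `σ ∈ ℤ`, `σ² = 1`, `m ≥ 1` and
`a m - u N v = 1`, then `[u/m]⁻_f = σ [v/m]⁻_f`. [cite: MazurTateTeitelbaum1986Invent, §I.17] -/
theorem IsFrickeEigen.normalizedMinusSymbol_div_eq_mul' {σ : ℤ} (hW : IsFrickeEigen N f (-(σ : ℂ)))
    (hσ : σ ^ 2 = 1) {m : ℕ} (hm : 0 < m) {a u v : ℤ} (huv : a * m - u * (N * v) = 1) :
    normalizedMinusSymbol f ((u : ℚ) / m) = σ * normalizedMinusSymbol f ((v : ℚ) / m) := by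
  have hε : (-(σ : ℂ)) ^ 2 = 1 := by rw [neg_sq]; exact_mod_cast hσ
  have h := hW.minusSymbol_div_eq_neg_mul' hε hm huv
  rw [neg_neg] at h
  simp only [normalizedMinusSymbol]
  rw [h, ← Complex.ofReal_intCast, Complex.im_ofReal_mul, mul_div_assoc]

end Symbols

section Rational

variable {N : ℕ} (f : CuspForm (Gamma0 N) 2)

/-- **A sign relation between real minus symbols passes to the rational minus symbols**: if
`[r]⁻_f = σ [r']⁻_f` in `ℝ` with `σ ∈ ℤ`, `σ² = 1`, then `ratMinusSymbol f r = σ · ratMinusSymbol f r'`.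
Twin of `ratPlusSymbol_eq_mul_of_normalizedPlusSymbol_eq`. [folklore] -/
theorem ratMinusSymbol_eq_mul_of_normalizedMinusSymbol_eq' {r r' : ℚ} {σ : ℤ} (hσ : σ ^ 2 = 1)
    (h : normalizedMinusSymbol f r = σ * normalizedMinusSymbol f r') :
    ratMinusSymbol f r = σ * ratMinusSymbol f r' := by
  unfold ratMinusSymbol
  by_cases h' : ∃ q : ℚ, (q : ℝ) = normalizedMinusSymbol f r'
  · have h1 : ∃ q : ℚ, (q : ℝ) = normalizedMinusSymbol f r := by
      obtain ⟨q', hq'⟩ := h'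
      refine ⟨σ * q', ?_⟩
      push_cast
      rw [h, ← hq']
    rw [dif_pos h1, dif_pos h']
    apply Rat.cast_injective (α := ℝ)
    push_cast
    rw [h1.choose_spec, h'.choose_spec, h]
  · have h1 : ¬ ∃ q : ℚ, (q : ℝ) = normalizedMinusSymbol f r := by
      rintro ⟨q, hq⟩
      refine h' ⟨σ * q, ?_⟩
      have hσ' : ((σ : ℝ)) ^ 2 = 1 := by exact_mod_cast hσ
      push_cast
      rw [hq, h, ← mul_assoc, ← sq, hσ', one_mul]
    rw [dif_neg h1, dif_neg h']
    simp

/-- **Fricke symmetry of the rational minus symbols**: `f(-1/(Nτ)) = -σ N τ² f(τ)`, `σ² = 1`, `m ≥ 1`,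
`a m - u N v = 1` ⇒ `ratMinusSymbol f (u/m) = σ · ratMinusSymbol f (v/m)`.
[cite: MazurTateTeitelbaum1986Invent, §I.17] -/
theorem ratMinusSymbol_div_eq_mul_of_isFrickeEigen' [NeZero N] {σ : ℤ}
    (hW : IsFrickeEigen N f (-(σ : ℂ))) (hσ : σ ^ 2 = 1) {m : ℕ} (hm : 0 < m) {a u v : ℤ}
    (huv : a * m - u * (N * v) = 1) :
    ratMinusSymbol f ((u : ℚ) / m) = σ * ratMinusSymbol f ((v : ℚ) / m) :=
  ratMinusSymbol_eq_mul_of_normalizedMinusSymbol_eq' f hσ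
    (hW.normalizedMinusSymbol_div_eq_mul' hσ hm huv)

end Rational

end Literature.NumberTheory.EllipticCurves.ModularForms

namespace Summit.BirchSwinnertonDyer.Rank1Residual.F1Sign2

/-! ## §1. Binomial series with `p`-adic exponents modulo `ω_n` (copies of the even file's §1) -/

section Binomial

variable {p : ℕ} [Fact p.Prime]

/-- `[T^e] G(ω) = Σ_{d ≤ e} [T^d]G · [T^e]ω^d` for `ω(0) = 0`. [folklore] -/
private theorem coeff_subst_eq_sum_range {R : Type*} [CommRing R] {ω : R⟦X⟧} (hω : constantCoeff ω = 0)
    (G : R⟦X⟧) (e : ℕ) :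
    coeff e (G.subst ω) = ∑ d ∈ Finset.range (e + 1), coeff d G * coeff e (ω ^ d) := by
  rw [coeff_subst' (HasSubst.of_constantCoeff_zero' hω),
    finsum_eq_sum_of_support_subset _ (s := Finset.range (e + 1)) ?_]
  · simp only [smul_eq_mul]
  · intro d hd
    simp only [Function.mem_support, ne_eq, Finset.coe_range, Set.mem_Iio] at hd ⊢
    by_contra hlt
    apply hd
    rw [coeff_of_lt_order e (lt_of_lt_of_le (by exact_mod_cast (by omega : e < d))
      (natCast_le_order_pow hω d)), smul_zero]

/-- `(1+T)^{k·y} = ((1+T)^k)^y` for `y ∈ ℤ_p`, `k ∈ ℕ` (Mahler continuity + density of `ℕ`).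
[folklore] -/
private theorem binomialSeries_natCast_mul_eq_subst (k : ℕ) (y : ℤ_[p]) :
    PowerSeries.binomialSeries ℤ_[p] ((k : ℤ_[p]) * y) =
      (PowerSeries.binomialSeries ℤ_[p] y).subst ((1 + X : ℤ_[p]⟦X⟧) ^ k - 1) := by
  set ω : ℤ_[p]⟦X⟧ := (1 + X) ^ k - 1 with hωdef
  have hω : constantCoeff ω = 0 := by simp [hωdef]
  have hωs : HasSubst ω := HasSubst.of_constantCoeff_zero' hω
  ext e
  suffices h : (fun z : ℤ_[p] ↦ coeff e (PowerSeries.binomialSeries ℤ_[p] ((k : ℤ_[p]) * z))) =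
      fun z ↦ coeff e ((PowerSeries.binomialSeries ℤ_[p] z).subst ω) from congrFun h y
  apply Continuous.ext_on PadicInt.denseRange_natCast
  · simp only [binomialSeries_coeff, smul_eq_mul, mul_one]
    exact (PadicInt.continuous_choose e).comp (continuous_const.mul continuous_id)
  · have hform : (fun z : ℤ_[p] ↦ coeff e ((PowerSeries.binomialSeries ℤ_[p] z).subst ω)) =
        fun z ↦ ∑ d ∈ Finset.range (e + 1), Ring.choose z d * coeff e (ω ^ d) := by
      funext z
      rw [coeff_subst_eq_sum_range hω]
      simp only [binomialSeries_coeff, smul_eq_mul, mul_one]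
    rw [hform]
    exact continuous_finsetSum _ fun d _ ↦ (PadicInt.continuous_choose d).mul continuous_const
  · rintro _ ⟨m, rfl⟩
    have h1 : ((k : ℤ_[p]) * (m : ℤ_[p])) = ((k * m : ℕ) : ℤ_[p]) := by push_cast; ring
    have hone : (1 : ℤ_[p]⟦X⟧).subst ω = 1 := by
      rw [← coe_substAlgHom hωs, map_one]
    simp only
    rw [h1, binomialSeries_nat, binomialSeries_nat, subst_pow hωs, subst_add hωs, hone,
      subst_X hωs, pow_mul, hωdef, add_sub_cancel]

/-- `(1+T)^{pⁿy} ≡ 1 (mod ω_n)` in `Λ`. [folklore] -/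
private theorem exists_binomialSeries_pow_mul_sub_one_eq (n : ℕ) (y : ℤ_[p]) :
    ∃ q : ℤ_[p]⟦X⟧, PowerSeries.binomialSeries ℤ_[p] (((p ^ n : ℕ) : ℤ_[p]) * y) - 1 =
      ((1 + X : ℤ_[p]⟦X⟧) ^ (p ^ n) - 1) * q := by
  set ω : ℤ_[p]⟦X⟧ := (1 + X) ^ (p ^ n) - 1 with hωdef
  have hω : constantCoeff ω = 0 := by simp [hωdef]
  have hωs : HasSubst ω := HasSubst.of_constantCoeff_zero' hω
  set G : ℤ_[p]⟦X⟧ := PowerSeries.binomialSeries ℤ_[p] y with hG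
  have hG1 : constantCoeff G = 1 := binomialSeries_constantCoeff y
  obtain ⟨H, hH⟩ : ∃ H : ℤ_[p]⟦X⟧, G - 1 = X * H := by
    refine ⟨PowerSeries.mk fun i ↦ coeff (i + 1) (G - 1), ?_⟩
    ext i
    rcases i with _ | i
    · simp [coeff_zero_eq_constantCoeff_apply, hG1]
    · rw [coeff_succ_X_mul, coeff_mk]
  refine ⟨H.subst ω, ?_⟩
  rw [binomialSeries_natCast_mul_eq_subst, ← hωdef, ← hG]
  have hGe : G = 1 + X * H := by rw [← hH]; ring
  have hone : (1 : ℤ_[p]⟦X⟧).subst ω = 1 := by rw [← coe_substAlgHom hωs, map_one]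
  conv_lhs => rw [hGe, subst_add hωs, hone, subst_mul hωs, subst_X hωs]
  ring

/-- `(1+T)^x ≡ (1+T)^m (mod ω_n)` whenever `toZModPow n x = m`. [folklore] -/
theorem exists_binomialSeries_sub_pow_eq {n : ℕ} {x : ℤ_[p]} {m : ℕ}
    (hx : PadicInt.toZModPow n x = (m : ZMod (p ^ n))) :
    ∃ q : ℤ_[p]⟦X⟧, PowerSeries.binomialSeries ℤ_[p] x - (1 + X : ℤ_[p]⟦X⟧) ^ m =
      ((1 + X : ℤ_[p]⟦X⟧) ^ (p ^ n) - 1) * q := by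
  have hker : x - (m : ℤ_[p]) ∈ RingHom.ker (PadicInt.toZModPow (p := p) n) := by
    rw [RingHom.mem_ker, map_sub, map_natCast, hx, sub_self]
  rw [PadicInt.ker_toZModPow, Ideal.mem_span_singleton] at hker
  obtain ⟨y, hy⟩ := hker
  obtain ⟨q, hq⟩ := exists_binomialSeries_pow_mul_sub_one_eq n y
  refine ⟨(1 + X : ℤ_[p]⟦X⟧) ^ m * q, ?_⟩
  have hx' : x = (m : ℤ_[p]) + ((p ^ n : ℕ) : ℤ_[p]) * y := by
    push_cast; linear_combination hy
  rw [hx', binomialSeries_add, binomialSeries_nat]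
  linear_combination ((1 + X : ℤ_[p]⟦X⟧) ^ m) * hq

end Binomial

/-! ## §2. The involution `ι` on `Λ` (copies of the even file's §2) -/

section Iota

variable {R : Type*} [CommRing R]

/-- `(1+T)^k · E^k = 1`, `E = 1 + ι = (1+T)⁻¹`. [folklore] -/
theorem one_add_X_pow_mul_E_pow (k : ℕ) :
    (1 + X : R⟦X⟧) ^ k * (invOnePlusSubOne + 1) ^ k = 1 := by
  rw [← mul_pow, one_add_X_mul_invOnePlusSubOne_add_one, one_pow]

/-- `ι(1 + T) = E`. [folklore] -/
theorem subst_invOnePlusSubOne_one_add_X :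
    (1 + X : R⟦X⟧).subst (invOnePlusSubOne : R⟦X⟧) = invOnePlusSubOne + 1 := by
  have hι := hasSubst_invOnePlusSubOne (R := R)
  rw [subst_add hι, subst_X hι, ← coe_substAlgHom hι, map_one, add_comm]

/-- `ι((1+T)^k) = E^k`. [folklore] -/
private theorem subst_invOnePlusSubOne_one_add_X_pow (k : ℕ) :
    ((1 + X : R⟦X⟧) ^ k).subst (invOnePlusSubOne : R⟦X⟧) = (invOnePlusSubOne + 1) ^ k := by
  rw [subst_pow hasSubst_invOnePlusSubOne, subst_invOnePlusSubOne_one_add_X]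

/-- `ι(ω_n) = −E^{q} · ω_n` for `ω = (1+T)^{q} − 1`. [folklore] -/
theorem subst_invOnePlusSubOne_omega (q : ℕ) :
    ((1 + X : R⟦X⟧) ^ q - 1).subst (invOnePlusSubOne : R⟦X⟧) =
      -(invOnePlusSubOne + 1) ^ q * ((1 + X : R⟦X⟧) ^ q - 1) := by
  have hι := hasSubst_invOnePlusSubOne (R := R)
  rw [subst_sub hι, subst_invOnePlusSubOne_one_add_X_pow, ← coe_substAlgHom hι, map_one]
  linear_combination (one_add_X_pow_mul_E_pow (R := R) q)

end Iota

/-! ## §3. Coefficient maps and readings in `ℚ_p⟦T⟧` (copies of the even file's helpers) -/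

section Maps

/-- `ι` has integer coefficients: it is fixed by any coefficient map. [folklore] -/
private theorem map_invOnePlusSubOne {R S : Type*} [CommRing R] [CommRing S] (φ : R →+* S) :
    PowerSeries.map φ (invOnePlusSubOne : R⟦X⟧) = invOnePlusSubOne := by
  ext n
  simp only [coeff_map, coeff_invOnePlusSubOne]
  split_ifs <;> simp

/-- `ι_Λ ∘ S = S ∘ ι_Λ`. [folklore] -/
theorem iwasawaToPowerSeries_subst_invOnePlusSubOne {p : ℕ} [Fact p.Prime]
    (g : IwasawaAlgebra p) :
    iwasawaToPowerSeries p (g.subst (invOnePlusSubOne : ℤ_[p]⟦X⟧)) =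
      (iwasawaToPowerSeries p g).subst (invOnePlusSubOne : ℚ_[p]⟦X⟧) := by
  have h := map_subst (hasSubst_invOnePlusSubOne (R := ℤ_[p])) (h := algebraMap ℤ_[p] ℚ_[p]) g
  have hι : MvPowerSeries.map (algebraMap ℤ_[p] ℚ_[p]) (invOnePlusSubOne : ℤ_[p]⟦X⟧) =
      (invOnePlusSubOne : ℚ_[p]⟦X⟧) := map_invOnePlusSubOne _
  rw [hι] at h
  exact h

/-- `ω_n = (1+T)^{pⁿ} − 1` as a power series over `ℤ_p`. [folklore] -/
theorem coe_map_cyclotomicOmega {p : ℕ} [Fact p.Prime] (n : ℕ) :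
    (((cyclotomicOmega p n).map (Int.castRingHom ℤ_[p]) : Polynomial ℤ_[p]) : ℤ_[p]⟦X⟧) =
      (1 + X : ℤ_[p]⟦X⟧) ^ (p ^ n) - 1 := by
  simp only [cyclotomicOmega, Polynomial.map_sub, Polynomial.map_pow, Polynomial.map_add,
    Polynomial.map_X, Polynomial.map_one, Polynomial.coe_sub, Polynomial.coe_pow,
    Polynomial.coe_add, Polynomial.coe_X, Polynomial.coe_one, add_comm]

/-- Coercion `R[T] → R⟦T⟧` of a finite sum. [folklore] -/
theorem coe_polynomial_sum {R : Type*} [CommSemiring R] {ι : Type*} (t : Finset ι)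
    (q : ι → Polynomial R) :
    (((∑ i ∈ t, q i : Polynomial R)) : R⟦X⟧) = ∑ i ∈ t, ((q i : Polynomial R) : R⟦X⟧) :=
  map_sum (Polynomial.coeToPowerSeries.ringHom (R := R)) q t

/-- `ι_Λ(ι) = ι`. [folklore] -/
theorem iwasawaToPowerSeries_invOnePlusSubOne {p : ℕ} [Fact p.Prime] :
    iwasawaToPowerSeries p (invOnePlusSubOne : ℤ_[p]⟦X⟧) = invOnePlusSubOne :=
  map_invOnePlusSubOne _

/-- `ι_Λ(u) = u` for the image `u` of an integer polynomial. [folklore] -/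
theorem iwasawaToPowerSeries_toIwasawa {p : ℕ} [Fact p.Prime] (q : Polynomial ℤ) :
    iwasawaToPowerSeries p (toIwasawa p q) =
      ((q.map (Int.castRingHom ℚ_[p]) : Polynomial ℚ_[p]) : ℚ_[p]⟦X⟧) := by
  change PowerSeries.map (algebraMap ℤ_[p] ℚ_[p])
    (((q.map (Int.castRingHom ℤ_[p])) : Polynomial ℤ_[p]) : ℤ_[p]⟦X⟧) = _
  rw [← Polynomial.polynomial_map_coe, Polynomial.map_map,
    RingHom.ext_int ((algebraMap ℤ_[p] ℚ_[p]).comp (Int.castRingHom ℤ_[p])) (Int.castRingHom ℚ_[p])]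

/-- `ι_Λ((1+T)^x) = (1+T)^x`. [folklore] -/
private theorem iwasawaToPowerSeries_binomialSeries {p : ℕ} [Fact p.Prime] (x : ℤ_[p]) :
    iwasawaToPowerSeries p (PowerSeries.binomialSeries ℤ_[p] x) =
      PowerSeries.binomialSeries ℚ_[p] x := by
  change PowerSeries.map (algebraMap ℤ_[p] ℚ_[p]) _ = _
  ext n
  rw [coeff_map, binomialSeries_coeff, binomialSeries_coeff, smul_eq_mul, mul_one, Algebra.smul_def,
    mul_one]

/-- From `L = σ(1+T)^{−x}L(T^ι)` with `σ² = 1` to `L(T^ι) = σ(1+T)^{x}L`. [folklore] -/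
theorem subst_invOnePlusSubOne_eq_of_eq_mul_subst {p : ℕ} [Fact p.Prime] {σ : ℤ}
    (hσ : σ ^ 2 = 1) {x : ℤ_[p]} {L : IwasawaAlgebra p}
    (h : L = (σ : IwasawaAlgebra p) * PowerSeries.binomialSeries ℤ_[p] (-x) *
      L.subst (invOnePlusSubOne : ℤ_[p]⟦X⟧)) :
    L.subst (invOnePlusSubOne : ℤ_[p]⟦X⟧) =
      (σ : IwasawaAlgebra p) * PowerSeries.binomialSeries ℤ_[p] x * L := by
  have hB : PowerSeries.binomialSeries ℤ_[p] x * PowerSeries.binomialSeries ℤ_[p] (-x) =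
      (1 : ℤ_[p]⟦X⟧) := by
    rw [← binomialSeries_add, add_neg_cancel, binomialSeries_zero]
  have hσ2 : (σ : IwasawaAlgebra p) * (σ : IwasawaAlgebra p) = 1 := by
    have h := congrArg (Int.cast : ℤ → IwasawaAlgebra p) hσ
    push_cast at h
    rw [← sq]; exact h
  calc L.subst (invOnePlusSubOne : ℤ_[p]⟦X⟧)
      = ((σ : IwasawaAlgebra p) * (σ : IwasawaAlgebra p)) *
          (PowerSeries.binomialSeries ℤ_[p] x * PowerSeries.binomialSeries ℤ_[p] (-x)) *
          L.subst (invOnePlusSubOne : ℤ_[p]⟦X⟧) := by rw [hσ2, hB, one_mul, one_mul]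
    _ = (σ : IwasawaAlgebra p) * PowerSeries.binomialSeries ℤ_[p] x *
          ((σ : IwasawaAlgebra p) * PowerSeries.binomialSeries ℤ_[p] (-x) *
            L.subst (invOnePlusSubOne : ℤ_[p]⟦X⟧)) := by ring
    _ = (σ : IwasawaAlgebra p) * PowerSeries.binomialSeries ℤ_[p] x * L := by rw [← h]

/-- Reading `L(T^ι) = σ(1+T)^x L` in `ℚ_p⟦T⟧`. [folklore] -/
theorem subst_iwasawaToPowerSeries_eq_of_subst_eq {p : ℕ} [Fact p.Prime] {σ : ℤ} {x : ℤ_[p]}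
    {L : IwasawaAlgebra p} (h : L.subst (invOnePlusSubOne : ℤ_[p]⟦X⟧) =
      (σ : IwasawaAlgebra p) * PowerSeries.binomialSeries ℤ_[p] x * L) :
    (iwasawaToPowerSeries p L).subst (invOnePlusSubOne : ℚ_[p]⟦X⟧) =
      C ((σ : ℤ) : ℚ_[p]) * PowerSeries.binomialSeries ℚ_[p] x * iwasawaToPowerSeries p L := by
  rw [← iwasawaToPowerSeries_subst_invOnePlusSubOne, h, map_mul, map_mul, map_intCast,
    iwasawaToPowerSeries_binomialSeries, ← map_intCast (C : ℚ_[p] →+* ℚ_[p]⟦X⟧) σ]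

end Maps

end Summit.BirchSwinnertonDyer.Rank1Residual.F1Sign2

end
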